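import Summits.Langlands.Langlands.Theorems.SoloInformedRepairD2StRing
import Summits.Langlands.Langlands.Theorems.SoloInformedRepairD2CrisGLOne
import Mathlib.LinearAlgebra.Dual.Lemmas
import HarnessLib
import HarnessLib.Audit.Tags

/-!
# Repair D2-st — the rank-two certificate: `D_st` of the Kummer extension `(χ a_p; 0 1)` over the
# constructed `B_st(F) = B_max(F)[X]` has Steinberg shape (`N_D ≠ 0`)

Companion to `Theorems/SoloInformedRepairD2StRing` (the constructed `B_st(F)`, `D_st`, `φ_D`, `N_D`) and
`Theorems/SoloInformedRepairD2St` (the clause `SemistableCompatibleAt`).  The one check of their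
NORMALISATION that the kernel can perform today without admissibility theory — the semistable,
non-crystalline rank-two example of the literature (the Tate curve with `q = p`; Berger, Ch. II,
"every extension of `ℚ_p` by `ℚ_p(1)` is semi-stable"):
* the Kummer cocycle of `p` makes `σ ↦ (χ(σ) a_p(σ); 0 1)` MULTIPLICATIVE (`kummerMatrix_mul`,
  `kummerMatrix_one`) — the content of the tree's `kummerExp_mul`;
* for any framed `ρ : Γ_F → GL_2(ℚ̄_p)` with these matrices (`hρ`; continuity is the caller's), the vectors
  `x_N := e₀ ⊗ t⁻¹` and `x_U := e₁ ⊗ 1 - e₀ ⊗ t⁻¹X` of `ℚ̄_p² ⊗_{ℚ_p} B_st(F)` lie in `D_st(ρ)`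
  (`xN_mem_Dst`, `xU_mem_Dst`: `σ(t⁻¹X) = χ(σ)⁻¹ t⁻¹ (X + a_p(σ) t)` and the `ℚ_p`-scalars move across `⊗`);
* `N_D x_U = x_N`, `N_D x_N = 0` (`NDst_xU`, `NDst_xN`), `φ_D x_N = p⁻¹ x_N`, `φ_D x_U = x_U`
  (`phiDst_xN`, `phiDst_xU`); and `x_N ≠ 0` once Fontaine's `θ` is surjective (`xN_ne_zero`), so
  `N_D ≠ 0` on `D_st(ρ)` (`NDst_ne_zero`): the representation is detected as semistable NON-crystalline,
  with `Φ = φ^f`-eigenvalues `1` (on `x_U`) and `q⁻¹` (on `x_N = N x_U`) — the string `Sp₂(1)`,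
  `N : V_1 → V_{q⁻¹}`, consistent with `N Φ = q Φ N` on both sides of `SemistableCompatibleAt` and with
  the Weil–Deligne type of a split-multiplicative elliptic curve (unramified twist of Steinberg).
That `D_st(ρ)` is EXACTLY `ℚ̄_p x_U ⊕ ℚ̄_p x_N` is the rank-two case of `B_st^{Γ_F} = F₀` and is not claimed.
-/

noncomputable section

open scoped MatrixGroups Polynomial TensorProduct
open Field Polynomial WittVector
open Literature.NumberTheory.GaloisRepresentations Literature.NumberTheory.PAdicHodge

namespace Summit.Langlands.Langlands.Theorems

namespace D2St

open D2Cris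

/-! ### §1 The Kummer matrices `(χ(σ) a_p(σ); 0 1)` -/

section CycOnly

variable {F : Type} [Field F] {p : ℕ} [Fact p.Prime]

/-- `χ(στ) = χ(σ) χ(τ)` in `ℚ_p`. [folklore] -/
theorem cycQp_mul (σ τ : absoluteGaloisGroup F) : cycQp (p := p) (σ * τ) = cycQp σ * cycQp τ := by
  simp only [cycQp, map_mul, Units.val_mul, PadicInt.coe_mul]

/-- `χ(1) = 1` in `ℚ_p`. [folklore] -/
theorem cycQp_one : cycQp (p := p) (1 : absoluteGaloisGroup F) = 1 := by
  simp only [cycQp, map_one, Units.val_one, PadicInt.coe_one]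

end CycOnly

variable {F : Type} [Field F] [ValuativeRel F] [TopologicalSpace F] [IsNonarchimedeanLocalField F]
  [CharZero F] {p : ℕ} [Fact p.Prime]

/-- The Kummer cocycle of `p` read in `ℚ_p`: `a_p(σ) ∈ ℤ_p ⊂ ℚ_p`.
[cite: BergerLaurent2004pAdicReps, Ch. II, Semi-stable representations] -/
def kumQp (σ : absoluteGaloisGroup F) : ℚ_[p] := ((kummerP p σ : ℤ_[p]) : ℚ_[p])

/-- `a_p(στ) = a_p(σ) + χ(σ) a_p(τ)` in `ℚ_p`. [cite: SerreGaloisCohomology1997, II §1.2] -/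
theorem kumQp_mul (σ τ : absoluteGaloisGroup F) :
    kumQp (p := p) (σ * τ) = kumQp σ + cycQp σ * kumQp τ := by
  simp only [kumQp, cycQp, kummerP_mul, PadicInt.coe_add, PadicInt.coe_mul]

/-- `a_p(1) = 0` in `ℚ_p`. [cite: SerreGaloisCohomology1997, II §1.2] -/
theorem kumQp_one : kumQp (p := p) (1 : absoluteGaloisGroup F) = 0 := by
  simp only [kumQp, kummerP_one, PadicInt.coe_zero]

/-- **The Kummer matrix `(χ(σ) a_p(σ); 0 1) ∈ M_2(ℚ̄_p)`** — the matrix of `σ` on `V_p` of the Tate curve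
`E_p = 𝔾_m/p^ℤ` (equivalently, of the Kummer extension of `1` by `ℚ_p(1)` cut out by `p^{1/p^∞}`) in the
basis `(e₀, e₁) = (t, "log p̃")`. [cite: BergerLaurent2004pAdicReps, Ch. II, Tate's elliptic curve] -/
def kummerMatrix (σ : absoluteGaloisGroup F) : Matrix (Fin 2) (Fin 2) (PadicAlgCl p) :=
  Matrix.of ![![algebraMap ℚ_[p] (PadicAlgCl p) (cycQp σ), algebraMap ℚ_[p] (PadicAlgCl p) (kumQp σ)],
    ![0, 1]]

/-- **Multiplicativity `M(στ) = M(σ) M(τ)`** — the cocycle law of `a_p`. [cite: SerreGaloisCohomology1997, II §1.2] -/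
theorem kummerMatrix_mul (σ τ : absoluteGaloisGroup F) :
    kummerMatrix (p := p) (σ * τ) = kummerMatrix σ * kummerMatrix τ := by
  ext i j
  fin_cases i <;> fin_cases j <;>
    simp [kummerMatrix, Matrix.mul_apply, Fin.sum_univ_two, cycQp_mul, kumQp_mul, map_add, map_mul, add_comm]

/-- `M(1) = 1`. [folklore] -/
theorem kummerMatrix_one : kummerMatrix (p := p) (1 : absoluteGaloisGroup F) = 1 := by
  ext i j
  fin_cases i <;> fin_cases j <;> simp [kummerMatrix, cycQp_one, kumQp_one]

/-- The basis vector `e₀ = (1, 0)` (the `χ`-line). [folklore] -/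
def e0 : Fin 2 → PadicAlgCl p := Pi.single 0 1

/-- The basis vector `e₁ = (0, 1)`. [folklore] -/
def e1 : Fin 2 → PadicAlgCl p := Pi.single 1 1

/-- `M(σ) e₀ = χ(σ) e₀` (a `ℚ_p`-scalar). [folklore] -/
theorem toLin'_kummerMatrix_e0 (σ : absoluteGaloisGroup F) :
    Matrix.toLin' (kummerMatrix (p := p) σ) e0 = cycQp (p := p) σ • (e0 : Fin 2 → PadicAlgCl p) := by
  ext i
  fin_cases i <;> simp [kummerMatrix, e0, Matrix.mulVec, dotProduct, Fin.sum_univ_two, Algebra.smul_def]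

/-- `M(σ) e₁ = a_p(σ) e₀ + e₁` (`ℚ_p`-scalars). [folklore] -/
theorem toLin'_kummerMatrix_e1 (σ : absoluteGaloisGroup F) :
    Matrix.toLin' (kummerMatrix (p := p) σ) e1 =
      kumQp (p := p) σ • (e0 : Fin 2 → PadicAlgCl p) + (e1 : Fin 2 → PadicAlgCl p) := by
  ext i
  fin_cases i <;> simp [kummerMatrix, e0, e1, Matrix.mulVec, dotProduct, Fin.sum_univ_two, Algebra.smul_def]

/-! ### §2 The period vectors in `ℚ̄_p² ⊗_{ℚ_p} B_st(F)` and the action of `Γ_F`, `N`, `φ` -/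

variable [Fact (¬ IsUnit (p : integerC F))] [IsAdicComplete (Ideal.span {(p : integerC F)}) (integerC F)]

/-- `t · t⁻¹ = 1` with part 1's name `tB` for `t`. [folklore] -/
theorem tB_mul_tInv : tB F p * tInv = 1 := algebraMap_tBmax_mul_tInv

/-- `a_p(σ) t · t⁻¹ = a_p(σ)` (a `ℚ_p`-scalar of `B_max(F)`). [folklore] -/
theorem logShift_mul_tInv (σ : absoluteGaloisGroup F) :
    logShift (p := p) σ * tInv = algebraMap ℚ_[p] (Bmax F p) (kumQp σ) := by
  rw [logShift, mul_assoc, tB_mul_tInv, mul_one, zpToBmax_eq_algebraMap]; rfl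

/-- `σ(t⁻¹) = χ(σ)⁻¹ t⁻¹` in `B_st(F)` (constants). [cite: FontaineAsterisque223III, Exp. II §2.3] -/
theorem galBst_C_tInv (σ : absoluteGaloisGroup F) :
    galBst (p := p) σ (C tInv) = (cycQp (p := p) σ)⁻¹ • C (tInv : Bmax F p) := by
  rw [galBst_C, galBmax_tInv, ← Algebra.smul_def, smul_C]

/-- **`σ(t⁻¹ X) = χ(σ)⁻¹ · t⁻¹X + (a_p(σ) χ(σ)⁻¹) · 1`** in `B_st(F)`. [cite: FontaineAsterisque223III, Exp. II §3] -/
theorem galBst_C_tInv_mul_X (σ : absoluteGaloisGroup F) :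
    galBst (p := p) σ (C tInv * X) =
      (cycQp (p := p) σ)⁻¹ • (C (tInv : Bmax F p) * X) +
        (kumQp (p := p) σ * (cycQp (p := p) σ)⁻¹) • (1 : (Bmax F p)[X]) := by
  rw [map_mul, galBst_X, galBst_C, galBmax_tInv, mul_add, ← C_mul, mul_comm (_ * tInv) (logShift σ),
    ← mul_assoc, mul_comm (logShift σ), mul_assoc, logShift_mul_tInv, ← map_mul, ← Algebra.smul_def, ← smul_C,
    smul_mul_assoc, ← Polynomial.algebraMap_apply, Algebra.algebraMap_eq_smul_one, mul_comm (kumQp σ)]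

/-- `φ(t⁻¹) = p⁻¹ t⁻¹` in `B_st(F)` (constants). [cite: FontaineAsterisque223III, Exp. II §2.3] -/
theorem frobBst_C_tInv : frobBst F p (C tInv) = (p : ℚ_[p])⁻¹ • C (tInv : Bmax F p) := by
  rw [frobBst_C, frobBmax_tInv, ← Algebra.smul_def, smul_C]

/-- **`φ(t⁻¹ X) = t⁻¹ X`** in `B_st(F)` (`φ t⁻¹ = p⁻¹ t⁻¹`, `φ X = p X`). [cite: FontaineAsterisque223III, Exp. II §3] -/
theorem frobBst_C_tInv_mul_X : frobBst F p (C tInv * X) = C (tInv : Bmax F p) * X := by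
  have hp : (p : ℚ_[p]) ≠ 0 := Nat.cast_ne_zero.2 (Fact.out : p.Prime).ne_zero
  rw [map_mul, frobBst_X, frobBst_C, frobBmax_tInv, ← mul_assoc, ← C_mul, mul_right_comm, ← map_natCast
    (algebraMap ℚ_[p] (Bmax F p)), ← map_mul, inv_mul_cancel₀ hp, map_one, one_mul]

/-- `N(t⁻¹ X) = -t⁻¹`. [cite: FontaineAsterisque223III, Exp. II §3] -/
theorem NBst_C_tInv_mul_X : NBst F p (C tInv * X) = -C (tInv : Bmax F p) := by
  rw [NBst_apply, derivative_C_mul_X]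

/-- The ambient module `ℚ̄_p² ⊗_{ℚ_p} B_st(F)`. [folklore] -/
abbrev Amb (F : Type) [Field F] [ValuativeRel F] [TopologicalSpace F] [IsNonarchimedeanLocalField F]
    [CharZero F] (p : ℕ) [Fact p.Prime] [Fact (¬ IsUnit (p : integerC F))]
    [IsAdicComplete (Ideal.span {(p : integerC F)}) (integerC F)] : Type :=
  (Fin 2 → PadicAlgCl p) ⊗[ℚ_[p]] (Bmax F p)[X]

variable (F p) in
/-- **`x_N := e₀ ⊗ t⁻¹`** (the `χ`-line's period vector; it will be `N x_U`).
[cite: BergerLaurent2004pAdicReps, Ch. II, Tate's elliptic curve] -/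
def xN : Amb F p := (e0 : Fin 2 → PadicAlgCl p) ⊗ₜ[ℚ_[p]] C (tInv : Bmax F p)

variable (F p) in
/-- **`x_U := e₁ ⊗ 1 - e₀ ⊗ t⁻¹X`** (Berger's `y = 1 ⊗ f - log[q̃] t⁻¹ ⊗ e` with `q = p`, `log[p̃] = X`).
[cite: BergerLaurent2004pAdicReps, Ch. II, Tate's elliptic curve] -/
def xU : Amb F p :=
  (e1 : Fin 2 → PadicAlgCl p) ⊗ₜ[ℚ_[p]] (1 : (Bmax F p)[X]) - (e0 : Fin 2 → PadicAlgCl p) ⊗ₜ[ℚ_[p]] (C tInv * X)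

/-- **`x_N ≠ 0`** (given `θ` surjective, so that `B_max(F) ≠ 0`): test against `φ ⊗ ψ` with `φ e₀ = 1`,
`ψ (t⁻¹) = 1` over the field `ℚ_p`. [folklore] -/
theorem xN_ne_zero (hF : Function.Surjective (fontaineTheta (integerC F) p)) : xN F p ≠ 0 := by
  haveI := nontrivial_bmax (F := F) (p := p) hF
  have he : (e0 : Fin 2 → PadicAlgCl p) ≠ 0 := by
    intro h
    simpa [e0] using congr_fun h 0
  have ht : (C (tInv : Bmax F p) : (Bmax F p)[X]) ≠ 0 := C_ne_zero.2 (Units.ne_zero _)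
  intro h
  obtain ⟨φ, hφ⟩ := Module.Projective.exists_dual_eq_one ℚ_[p] he
  obtain ⟨ψ, hψ⟩ := Module.Projective.exists_dual_eq_one ℚ_[p] ht
  have := congrArg (fun x => TensorProduct.lid ℚ_[p] ℚ_[p] (TensorProduct.map φ ψ x)) h
  simp only [xN, TensorProduct.map_tmul, TensorProduct.lid_tmul, hφ, hψ, smul_eq_mul, mul_one,
    map_zero] at this
  exact one_ne_zero this

section Rep

variable (ρv : FramedRep (absoluteGaloisGroup F) (PadicAlgCl p) 2)
  (hρ : ∀ σ, ((ρv σ : GL (Fin 2) (PadicAlgCl p)) : Matrix (Fin 2) (Fin 2) (PadicAlgCl p)) = kummerMatrix σ)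
include hρ

/-- **`x_N ∈ D_st(ρ)`**: `(χ e₀) ⊗ (χ⁻¹ t⁻¹) = e₀ ⊗ t⁻¹`. [cite: BergerLaurent2004pAdicReps, Ch. II, Tate's elliptic curve] -/
theorem xN_mem_Dst : xN F p ∈ Dst (p := p) ρv := by
  intro σ
  show diagAct _ _ σ (xN F p) = xN F p
  simp only [diagAct, xN, TensorProduct.AlgebraTensorModule.map_tmul, AlgHom.toLinearMap_apply, hρ,
    toLin'_kummerMatrix_e0]
  rw [show galBstAlgHom (F := F) (p := p) σ (C tInv) = galBst σ (C tInv) from rfl, galBst_C_tInv,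
    TensorProduct.smul_tmul, smul_smul, mul_inv_cancel₀ (cycQp_ne_zero σ), one_smul]

/-- **`x_U ∈ D_st(ρ)`**: `(a e₀ + e₁) ⊗ 1 - (χ e₀) ⊗ (χ⁻¹ t⁻¹X + aχ⁻¹) = e₁ ⊗ 1 - e₀ ⊗ t⁻¹X`.
[cite: BergerLaurent2004pAdicReps, Ch. II, Tate's elliptic curve] -/
theorem xU_mem_Dst : xU F p ∈ Dst (p := p) ρv := by
  intro σ
  show diagAct _ _ σ (xU F p) = xU F p
  simp only [diagAct, xU, map_sub, TensorProduct.AlgebraTensorModule.map_tmul, AlgHom.toLinearMap_apply, hρ,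
    toLin'_kummerMatrix_e0, toLin'_kummerMatrix_e1, map_one]
  have hs : cycQp (p := p) σ * (kumQp σ * (cycQp σ)⁻¹) = kumQp σ := by
    rw [mul_comm (kumQp σ), ← mul_assoc, mul_inv_cancel₀ (cycQp_ne_zero σ), one_mul]
  rw [show galBstAlgHom (F := F) (p := p) σ (C tInv * X) = galBst σ (C tInv * X) from rfl,
    galBst_C_tInv_mul_X]
  simp only [TensorProduct.add_tmul, TensorProduct.tmul_add, TensorProduct.smul_tmul, smul_smul,
    mul_inv_cancel₀ (cycQp_ne_zero σ), one_smul, hs]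
  abel

/-- **`N_D x_U = x_N`** on `D_st(ρ)`: the monodromy of the Kummer extension is NON-ZERO-SHAPED (`N = -d/dX`
hits `-e₀ ⊗ t⁻¹X`). [cite: BergerLaurent2004pAdicReps, Ch. II, Tate's elliptic curve] -/
theorem NDst_xU :
    NDst (p := p) ρv ⟨xU F p, xU_mem_Dst ρv hρ⟩ = ⟨xN F p, xN_mem_Dst ρv hρ⟩ := by
  refine Subtype.ext ?_
  change endTensor (NBst F p) (xU F p) = xN F p
  simp only [endTensor, xU, xN, map_sub, TensorProduct.AlgebraTensorModule.map_tmul, LinearMap.id_apply,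
    NBst_apply, derivative_one, neg_zero, TensorProduct.tmul_zero, derivative_C_mul_X, TensorProduct.tmul_neg,
    sub_neg_eq_add, zero_add]

/-- **`N_D x_N = 0`.** [cite: BergerLaurent2004pAdicReps, Ch. II, Tate's elliptic curve] -/
theorem NDst_xN : NDst (p := p) ρv ⟨xN F p, xN_mem_Dst ρv hρ⟩ = 0 := by
  refine Subtype.ext ?_
  change endTensor (NBst F p) (xN F p) = 0
  simp only [endTensor, xN, TensorProduct.AlgebraTensorModule.map_tmul, LinearMap.id_apply, NBst_apply,
    derivative_C, neg_zero, TensorProduct.tmul_zero]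

/-- **`φ_D x_N = p⁻¹ x_N`** (so `Φ = φ^f = q⁻¹` on `x_N`). [cite: BergerLaurent2004pAdicReps, Ch. II, Tate's elliptic curve] -/
theorem phiDst_xN :
    ((phiDst (p := p) ρv ⟨xN F p, xN_mem_Dst ρv hρ⟩ : Dst ρv) : Amb F p) = (p : ℚ_[p])⁻¹ • xN F p := by
  change phiTensor (frobBstAlgHom F p) (xN F p) = _
  simp only [phiTensor, xN, TensorProduct.AlgebraTensorModule.map_tmul, LinearMap.id_apply,
    AlgHom.toLinearMap_apply]
  rw [show frobBstAlgHom F p (C tInv) = frobBst F p (C tInv) from rfl, frobBst_C_tInv, TensorProduct.tmul_smul]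

/-- **`φ_D x_U = x_U`** (so `Φ = 1` on `x_U`). [cite: BergerLaurent2004pAdicReps, Ch. II, Tate's elliptic curve] -/
theorem phiDst_xU :
    ((phiDst (p := p) ρv ⟨xU F p, xU_mem_Dst ρv hρ⟩ : Dst ρv) : Amb F p) = xU F p := by
  change phiTensor (frobBstAlgHom F p) (xU F p) = _
  simp only [phiTensor, xU, map_sub, TensorProduct.AlgebraTensorModule.map_tmul, LinearMap.id_apply,
    AlgHom.toLinearMap_apply, map_one]
  rw [show frobBstAlgHom F p (C tInv * X) = frobBst F p (C tInv * X) from rfl, frobBst_C_tInv_mul_X]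

/-- **`N_D ≠ 0` on `D_st` of the Kummer extension** (given `θ` surjective): the constructed functor sees the
extension of `1` by `ℚ_p(1)` cut out by `p^{1/p^∞}` as semistable and NOT crystalline — Steinberg shape,
as `SemistableCompatibleAt` demands at a place of split multiplicative reduction.
[cite: BergerLaurent2004pAdicReps, Ch. II, Tate's elliptic curve] -/
theorem NDst_ne_zero (hF : Function.Surjective (fontaineTheta (integerC F) p)) : NDst (p := p) ρv ≠ 0 := by
  intro h
  have h1 := NDst_xU ρv hρ
  rw [h, LinearMap.zero_apply] at h1
  exact xN_ne_zero hF (congrArg Subtype.val h1).symm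

end Rep

end D2St

end Summit.Langlands.Langlands.Theorems

end
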